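import Literature.AlgebraicGeometry.Frobenioids.BaseFrobeniusSections
import Literature.AlgebraicGeometry.Frobenioids.ModelFrobenioidBaseSection
import Literature.AlgebraicGeometry.Frobenioids.DegreeModelFrobenioid
import HarnessLib

/-!
# Frobenioids I, Definition 2.7 (ii)/(iii): the universal closures of the DEFINITIONAL predicates
# `IsFrobeniusSection`, `IsBaseFrobeniusPair`, `QuasiEqFrobeniusSection` are false; their instance
# forms hold at the model Frobenioid of `(pt, ℕ, 0, 0)`; "quasi-Frobenius-section" is an equivalence relation

Mochizuki, *The geometry of Frobenioids I: the general theory*, Kyushu J. Math. **62** (2008)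
293–400, §2, Definition 2.7 (ii) p. 51 and (iii) p. 52 [cite: MochizukiFrdI2008, Def. 2.7(ii) p.51]
[cite: MochizukiFrdI2008, Def. 2.7(iii) p.52]: "a *[P-]Frobenius-section* of `C` is … a homomorphism of
monoids `F : ℕ_{≥1} → End(P ↪ C)` such that (a) the composite of `F` with the map to `ℕ_{≥1}`
obtained by considering the Frobenius degree is the identity on `ℕ_{≥1}`; (b) … base-identity
endomorphisms of Frobenius type … We shall refer to a Frobenius-section … regarded as being known
only up to composition with automorphisms of the monoid `ℕ_{≥1}` … as a *quasi-Frobenius-section*";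
"(iii) … a *base-Frobenius pair* of `C`. If `C` admits a base-Frobenius pair, then we shall say that
`C` is of *pre-model type*"; proof of Theorem 5.2, p. 101 [cite: MochizukiFrdI2008, Thm. 5.2 p.101]:
the objects `(A_D, 0)` with the morphisms `Div(φ) = 0`, `u_φ = 1` "determine a base-Frobenius pair".

PROOF-ONLY companion of `BaseFrobeniusSections.lean` (abc-iut cell, seat abc-iut-f-021, FACT-LIST rows
F-2304 `IsFrobeniusSection`, F-2305 `IsBaseFrobeniusPair`, F-0933 `QuasiEqFrobeniusSection`; theorems
only, no definition, no instance).  The three declarations are DEFINITIONS of [FrdI] Def. 2.7 — predicates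
in the free binders `(F, P, Fr)` resp. `(P, Fr, Fr')` — not claims; this file records the kernel facts that classify
them:
* §1 (schema, any pre-Frobenioid `F`, any subcategory `P`): the TRIVIAL homomorphism
  `1 : ℕ_{≥1} → End(P ↪ C)` violates condition (a) on every object of `P`
  (`not_isFrobeniusSection_one`, `not_isBaseFrobeniusPair_one`; `deg_Fr(id) = 1 ≠ 2`), so a
  Frobenius-section is never `1` (`IsFrobeniusSection.ne_one`) and is not quasi-equal to `1`
  (`quasiEqFrobeniusSection_one_iff`); `QuasiEqFrobeniusSection P` is an equivalence relation
  (`quasiEqFrobeniusSection_equivalence` — "regarded as known only up to composition with automorphisms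
  of `ℕ_{≥1}`"), and two Frobenius-sections in one class are EQUAL (`IsFrobeniusSection.eq_of_quasiEq`:
  condition (a) pins the automorphism to the identity);
* §2 (instance forms, hypothesis-free): at the model Frobenioid `DegreeModel.C` of `(pt, ℕ, 0, 0)`
  (`DegreeModelFrobenioid.lean`; a Frobenioid, `DegreeModel.hF`) the zero section of the proof of
  Thm. 5.2 (`ModelFrobenioid.zeroPresection` / `zeroFrobeniusSection`, `ModelFrobenioidBaseSection.lean`,
  whose `ModelFrobenioid.isBaseFrobeniusPair_zero` carries the standing hypotheses `Φ` divisorial, `B`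
  group-like, `D` skeletal) IS a base-Frobenius pair with all hypotheses discharged
  (`DegreeModel.isBaseFrobeniusPair_zero`, `DegreeModel.isFrobeniusSection_zero`,
  `DegreeModel.isOfPreModelType`); another hypothesis-free instance in the tree is the archimedean one,
  `ArchFrd.C.isBaseFrobeniusPair_std` (`ArchimedeanPreModelType.lean`);
* §3 hence the UNIVERSAL CLOSURES over the free binders are FALSE (`not_forall_isFrobeniusSection`,
  `not_forall_isBaseFrobeniusPair`, `not_forall_quasiEqFrobeniusSection`, kernel counter-instances at
  universe `0`): the rows are schemata, consumable only as the hypotheses / instance forms they are.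
No statement of the paper is strengthened or disputed: Def. 2.7 defines, it does not assert.  Nothing
here bears on [IUTchIII] Cor. 3.12.
-/

namespace Literature.AlgebraicGeometry.Frobenioids

open CategoryTheory Opposite

/-! ### §1 The schema: generic facts over `(F, P, Fr)` -/

namespace PreFrobenioid

universe w v v' u u'

variable {D : Type u} [Category.{v} D] {Φ : Dᵒᵖ ⥤ CommMonCat.{w}}
  {C : Type u'} [Category.{v'} C] (F : C ⥤ ElemFrobenioid Φ) (P : Presection C)

/-- The trivial homomorphism `1 : ℕ_{≥1} → End(P ↪ C)` (every `F(n)` the identity natural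
transformation) is NOT a `P`-Frobenius-section as soon as `P` has an object: condition (a) of
Def. 2.7 (ii) fails at `n = 2`, since `deg_Fr(id_A) = 1`. [cite: MochizukiFrdI2008, Def. 2.7(ii) p.51] -/
theorem not_isFrobeniusSection_one (A : P.Cat) : ¬ IsFrobeniusSection F P 1 := by
  intro h
  have h2 := h.degFr_eq 2 A
  rw [MonoidHom.one_apply, End.one_def, NatTrans.id_app, degFr_id] at h2
  exact absurd h2 (by decide)

/-- Hence the trivial homomorphism is not the Frobenius half of a base-Frobenius pair (Def. 2.7 (iii))
on a subcategory with an object. [cite: MochizukiFrdI2008, Def. 2.7(iii) p.52] -/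
theorem not_isBaseFrobeniusPair_one (A : P.Cat) : ¬ IsBaseFrobeniusPair F P 1 :=
  fun h => not_isFrobeniusSection_one F P A h.isFrobeniusSection

variable {F P}

/-- A `P`-Frobenius-section on a subcategory with an object is not the trivial homomorphism.
[cite: MochizukiFrdI2008, Def. 2.7(ii) p.51] -/
theorem IsFrobeniusSection.ne_one {Fr : ℕ+ →* End P.ι} (h : IsFrobeniusSection F P Fr) (A : P.Cat) :
    Fr ≠ 1 := fun e => not_isFrobeniusSection_one F P A (e ▸ h)

/-- The Frobenius half of a base-Frobenius pair on a subcategory with an object is not the trivial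
homomorphism. [cite: MochizukiFrdI2008, Def. 2.7(iii) p.52] -/
theorem IsBaseFrobeniusPair.ne_one {Fr : ℕ+ →* End P.ι} (h : IsBaseFrobeniusPair F P Fr) (A : P.Cat) :
    Fr ≠ 1 := h.isFrobeniusSection.ne_one A

variable (F P)

/-- "Quasi-Frobenius-section" (known up to an automorphism of `ℕ_{≥1}`) is REFLEXIVE: `Fr = Fr ∘ id`.
[cite: MochizukiFrdI2008, Def. 2.7(ii) p.51] -/
theorem quasiEqFrobeniusSection_refl (Fr : ℕ+ →* End P.ι) : QuasiEqFrobeniusSection P Fr Fr :=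
  ⟨MulEquiv.refl _, MonoidHom.ext fun _ => rfl⟩

variable {F P}

/-- … SYMMETRIC: `Fr' = Fr ∘ σ` gives `Fr = Fr' ∘ σ⁻¹`. [cite: MochizukiFrdI2008, Def. 2.7(ii) p.51] -/
theorem QuasiEqFrobeniusSection.symm {Fr Fr' : ℕ+ →* End P.ι} (h : QuasiEqFrobeniusSection P Fr Fr') :
    QuasiEqFrobeniusSection P Fr' Fr := by
  obtain ⟨σ, rfl⟩ := h
  refine ⟨σ.symm, MonoidHom.ext fun n => ?_⟩
  rw [MonoidHom.comp_apply, MonoidHom.comp_apply, MulEquiv.coe_toMonoidHom, MulEquiv.coe_toMonoidHom,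
    MulEquiv.apply_symm_apply]

/-- … TRANSITIVE: `Fr' = Fr ∘ σ`, `Fr'' = Fr' ∘ τ` give `Fr'' = Fr ∘ (σ ∘ τ)`.
[cite: MochizukiFrdI2008, Def. 2.7(ii) p.51] -/
theorem QuasiEqFrobeniusSection.trans {Fr Fr' Fr'' : ℕ+ →* End P.ι}
    (h : QuasiEqFrobeniusSection P Fr Fr') (h' : QuasiEqFrobeniusSection P Fr' Fr'') :
    QuasiEqFrobeniusSection P Fr Fr'' := by
  obtain ⟨σ, rfl⟩ := h
  obtain ⟨τ, rfl⟩ := h'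
  exact ⟨τ.trans σ, MonoidHom.ext fun _ => rfl⟩

variable (F P)

/-- **"Quasi-Frobenius-section" is an equivalence relation** on homomorphisms `ℕ_{≥1} → End(P ↪ C)` —
the relation by which Def. 2.7 (ii) regards a Frobenius-section "as being known only up to composition
with automorphisms of the monoid `ℕ_{≥1}`". [cite: MochizukiFrdI2008, Def. 2.7(ii) p.51] -/
theorem quasiEqFrobeniusSection_equivalence : Equivalence (QuasiEqFrobeniusSection P) :=
  ⟨quasiEqFrobeniusSection_refl P, fun h => h.symm, fun h h' => h.trans h'⟩

/-- The class of the trivial homomorphism is a singleton: `Fr'` is quasi-equal to `1` iff `Fr' = 1`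
(`1 ∘ σ = 1`). [cite: MochizukiFrdI2008, Def. 2.7(ii) p.51] -/
theorem quasiEqFrobeniusSection_one_iff (Fr' : ℕ+ →* End P.ι) :
    QuasiEqFrobeniusSection P 1 Fr' ↔ Fr' = 1 := by
  refine ⟨fun ⟨σ, e⟩ => e.trans (MonoidHom.one_comp _), fun e => ?_⟩
  subst e
  exact quasiEqFrobeniusSection_refl P 1

variable {F P}

/-- In particular a Frobenius-section (on a subcategory with an object) is not quasi-equal to the
trivial homomorphism. [cite: MochizukiFrdI2008, Def. 2.7(ii) p.51] -/
theorem IsFrobeniusSection.not_quasiEq_one {Fr : ℕ+ →* End P.ι} (h : IsFrobeniusSection F P Fr)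
    (A : P.Cat) : ¬ QuasiEqFrobeniusSection P 1 Fr :=
  fun hq => h.ne_one A ((quasiEqFrobeniusSection_one_iff P Fr).mp hq)

/-- OUR remark (rigidity of condition (a)): two `P`-Frobenius-sections that are quasi-equal are EQUAL —
if `Fr' = Fr ∘ σ` then `deg_Fr` of `Fr'(n)_A` is both `n` and `σ(n)`, so `σ = id` (needs an object `A`
of `P`).  Thus each quasi-Frobenius-section class contains at most one Frobenius-section; the other
members are its reparametrisations `Fr ∘ σ`. [cite: MochizukiFrdI2008, Def. 2.7(ii) p.51] -/
theorem IsFrobeniusSection.eq_of_quasiEq {Fr Fr' : ℕ+ →* End P.ι} (h : IsFrobeniusSection F P Fr)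
    (h' : IsFrobeniusSection F P Fr') (A : P.Cat) (hq : QuasiEqFrobeniusSection P Fr Fr') :
    Fr = Fr' := by
  obtain ⟨σ, rfl⟩ := hq
  have hσ : ∀ n, σ n = n := fun n => by
    have e := h'.degFr_eq n A
    rw [MonoidHom.comp_apply, MulEquiv.coe_toMonoidHom, h.degFr_eq] at e
    exact e
  refine MonoidHom.ext fun n => ?_
  rw [MonoidHom.comp_apply, MulEquiv.coe_toMonoidHom, hσ]

end PreFrobenioid

/-! ### §2 Instance forms, hypothesis-free: the zero section of the model Frobenioid of `(pt, ℕ, 0, 0)` -/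

namespace DegreeModel

/-- The one-morphism base category `D = {pt}` is skeletal. [cite: MochizukiFrdI2008, Thm. 5.2 p.101] -/
theorem skeletal_D : Skeletal D := fun X Y _ => Discrete.ext (Subsingleton.elim X.as Y.as)

/-- **Def. 2.7 (iii) inhabited, no hypothesis left**: the zero section `P = {(pt, 0)}` with its
Frobenius endomorphisms `n ↦ (n, id, 0, 1)` is a base-Frobenius pair of the model Frobenioid `C` of
`(pt, ℕ, 0, 0)` — `ModelFrobenioid.isBaseFrobeniusPair_zero` (proof of Thm. 5.2, p. 101) with its three
standing hypotheses discharged: `(ℕ, +)` divisorial, `0_D` group-like, `{pt}` skeletal.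
[cite: MochizukiFrdI2008, Thm. 5.2 p.101] -/
theorem isBaseFrobeniusPair_zero :
    PreFrobenioid.IsBaseFrobeniusPair F (ModelFrobenioid.zeroPresection natΦ B DivB)
      (ModelFrobenioid.zeroFrobeniusSection natΦ B DivB) :=
  ModelFrobenioid.isBaseFrobeniusPair_zero objectwise_isDivisorial_natΦ objectwise_isGroupLike_B skeletal_D

/-- **Def. 2.7 (ii) inhabited, no hypothesis left**: `n ↦ (n, id, 0, 1)` is a `P`-Frobenius-section of
the model Frobenioid of `(pt, ℕ, 0, 0)` for the zero section `P`. [cite: MochizukiFrdI2008, Def. 2.7(ii) p.51] -/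
theorem isFrobeniusSection_zero :
    PreFrobenioid.IsFrobeniusSection F (ModelFrobenioid.zeroPresection natΦ B DivB)
      (ModelFrobenioid.zeroFrobeniusSection natΦ B DivB) :=
  isBaseFrobeniusPair_zero.isFrobeniusSection

/-- The zero section of the model Frobenioid of `(pt, ℕ, 0, 0)` is a base-section (Def. 2.7 (i)), no
hypothesis left. [cite: MochizukiFrdI2008, Def. 2.7(i) p.51] -/
theorem isBaseSection_zero :
    PreFrobenioid.IsBaseSection F (ModelFrobenioid.zeroPresection natΦ B DivB) :=
  isBaseFrobeniusPair_zero.isBaseSection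

/-- Hence the model Frobenioid of `(pt, ℕ, 0, 0)` is of pre-model type (Def. 2.7 (iii)), no hypothesis
left. [cite: MochizukiFrdI2008, Def. 2.7(iii) p.52] -/
theorem isOfPreModelType : PreFrobenioid.IsOfPreModelType F :=
  ⟨_, _, isBaseFrobeniusPair_zero⟩

/-- The Frobenius-section `n ↦ (n, id, 0, 1)` of the zero section is not the trivial homomorphism
(`P` has the object `(pt, 0)`). [cite: MochizukiFrdI2008, Thm. 5.2 p.101] -/
theorem zeroFrobeniusSection_ne_one : ModelFrobenioid.zeroFrobeniusSection natΦ B DivB ≠ 1 :=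
  isFrobeniusSection_zero.ne_one ⟨ModelFrobenioid.zeroObj natΦ B DivB pt, rfl⟩

/-- `QuasiEqFrobeniusSection` inhabited at the model: the Frobenius-section of the zero section is
quasi-equal to itself. [cite: MochizukiFrdI2008, Def. 2.7(ii) p.51] -/
theorem quasiEqFrobeniusSection_zero :
    PreFrobenioid.QuasiEqFrobeniusSection (ModelFrobenioid.zeroPresection natΦ B DivB)
      (ModelFrobenioid.zeroFrobeniusSection natΦ B DivB) (ModelFrobenioid.zeroFrobeniusSection natΦ B DivB) :=
  PreFrobenioid.quasiEqFrobeniusSection_refl _ _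

/-- … and NOT quasi-equal to the trivial homomorphism. [cite: MochizukiFrdI2008, Def. 2.7(ii) p.51] -/
theorem not_quasiEqFrobeniusSection_one_zero :
    ¬ PreFrobenioid.QuasiEqFrobeniusSection (ModelFrobenioid.zeroPresection natΦ B DivB) 1
      (ModelFrobenioid.zeroFrobeniusSection natΦ B DivB) :=
  isFrobeniusSection_zero.not_quasiEq_one ⟨ModelFrobenioid.zeroObj natΦ B DivB pt, rfl⟩

end DegreeModel

/-! ### §3 The universal closures over the free binders are false -/

namespace PreFrobenioid

/-- **The universal closure of `IsFrobeniusSection` is FALSE** (Def. 2.7 (ii) is a definition, not a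
claim): at the model Frobenioid of `(pt, ℕ, 0, 0)`, the zero section and the trivial homomorphism
`Fr = 1`, condition (a) fails. [cite: MochizukiFrdI2008, Def. 2.7(ii) p.51] -/
theorem not_forall_isFrobeniusSection :
    ¬ ∀ {D : Type} [Category.{0} D] {Φ : Dᵒᵖ ⥤ CommMonCat.{0}} {C : Type} [Category.{0} C]
        (F : C ⥤ ElemFrobenioid Φ) (P : Presection C) (Fr : ℕ+ →* End P.ι),
        IsFrobeniusSection F P Fr :=
  fun h => not_isFrobeniusSection_one DegreeModel.F
    (ModelFrobenioid.zeroPresection DegreeModel.natΦ DegreeModel.B DegreeModel.DivB)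
    ⟨ModelFrobenioid.zeroObj _ _ _ DegreeModel.pt, rfl⟩ (h DegreeModel.F _ 1)

/-- **The universal closure of `IsBaseFrobeniusPair` is FALSE** (Def. 2.7 (iii) is a definition): same
counter-instance, `Fr = 1` on the zero section of the model Frobenioid of `(pt, ℕ, 0, 0)`.
[cite: MochizukiFrdI2008, Def. 2.7(iii) p.52] -/
theorem not_forall_isBaseFrobeniusPair :
    ¬ ∀ {D : Type} [Category.{0} D] {Φ : Dᵒᵖ ⥤ CommMonCat.{0}} {C : Type} [Category.{0} C]
        (F : C ⥤ ElemFrobenioid Φ) (P : Presection C) (Fr : ℕ+ →* End P.ι),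
        IsBaseFrobeniusPair F P Fr :=
  fun h => not_isBaseFrobeniusPair_one DegreeModel.F
    (ModelFrobenioid.zeroPresection DegreeModel.natΦ DegreeModel.B DegreeModel.DivB)
    ⟨ModelFrobenioid.zeroObj _ _ _ DegreeModel.pt, rfl⟩ (h DegreeModel.F _ 1)

/-- **The universal closure of `QuasiEqFrobeniusSection` is FALSE** (it is an equivalence RELATION,
Def. 2.7 (ii)): the trivial homomorphism and the Frobenius-section of the zero section of the model
Frobenioid of `(pt, ℕ, 0, 0)` lie in different classes. [cite: MochizukiFrdI2008, Def. 2.7(ii) p.51] -/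
theorem not_forall_quasiEqFrobeniusSection :
    ¬ ∀ {C : Type} [Category.{0} C] (P : Presection C) (Fr Fr' : ℕ+ →* End P.ι),
        QuasiEqFrobeniusSection P Fr Fr' :=
  fun h => DegreeModel.not_quasiEqFrobeniusSection_one_zero
    (h (ModelFrobenioid.zeroPresection DegreeModel.natΦ DegreeModel.B DegreeModel.DivB) 1
      (ModelFrobenioid.zeroFrobeniusSection _ _ _))

end PreFrobenioid

end Literature.AlgebraicGeometry.Frobenioids
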